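import Summits.HodgeConjecture.HodgeCM.Literature.GaoUllmoTheorem31_2

/-! PORT of `HodgeCM/Literature/GaoUllmoTheorem31.lean` (HodgeCMPerL run 81) — part 3: continuation of `Summits.HodgeConjecture.HodgeCM.Literature.GaoUllmoTheorem31_2` (split at a top-level declaration boundary by port_pkg.py; scope re-opened below; declarations unchanged). -/

-- port_pkg: scope re-opened for this part (file-level context, then the namespace/section stack open at the cut)
noncomputable section
open Module
attribute [local instance] Classical.propDecidable
namespace HodgeCM
namespace GaoUllmo
section Final
variable {E : Type} [CommRing E] [Algebra ℚ E] [Module.Finite ℚ E] [LinearOrder (Emb E)]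
/-- **Inversion** (`det(σ(u_j)) ≠ 0`): `[P]` is a `ℂ`-combination of the `f_{u_j}`, `u_j` a `ℚ`-basis of `E^c`. -/
theorem wedge_mem_span_fvec (r : ℕ) (P : Set.powersetCard (Emb E) r) :
    wedge E r P ∈ Submodule.span ℂ (Set.range fun u : galoisClosure E => fvec r P u) := by
  set d := finrank ℚ (galoisClosure E)
  set uB : Basis (Fin d) ℚ (galoisClosure E) := Module.finBasis ℚ (galoisClosure E)
  have hcard : Fintype.card (Fin d) = Fintype.card (galoisClosure E →ₐ[ℚ] ℂ) := by
    rw [Fintype.card_fin, AlgHom.card]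
  set ε : Fin d ≃ (galoisClosure E →ₐ[ℚ] ℂ) := Fintype.equivOfCardEq hcard
  set U : Matrix (Fin d) (Fin d) ℂ := Algebra.embeddingsMatrixReindex ℚ ℂ (⇑uB) ε with hU
  have hUapply : ∀ j l, U j l = (ε l) (uB j) := by
    intro j l; simp [hU, Algebra.embeddingsMatrixReindex, Algebra.embeddingsMatrix]
  have hdet : U.det ≠ 0 := by
    intro h0
    have h1 := Algebra.discr_eq_det_embeddingsMatrixReindex_pow_two ℚ ℂ (⇑uB) ε
    rw [← hU, h0, zero_pow two_ne_zero, map_eq_zero] at h1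
    exact Algebra.discr_not_zero_of_basis ℚ uB h1
  have hfvec : ∀ j, fvec r P (uB j) = ∑ l, U j l • Tvec r P (ε l) := by
    intro j
    unfold fvec
    rw [← Equiv.sum_comp ε]
    simp_rw [hUapply]
  set V := U⁻¹
  have hVU : V * U = 1 := Matrix.nonsing_inv_mul _ (isUnit_iff_ne_zero.mpr hdet)
  set l₀ := ε.symm (galoisClosure E).val
  have hcomb : ∑ j, V l₀ j • fvec r P (uB j) = wedge E r P := by
    simp_rw [hfvec, Finset.smul_sum, smul_smul]
    rw [Finset.sum_comm]
    have : ∀ l, ∑ j, (V l₀ j * U j l) • Tvec r P (ε l) = ((V * U) l₀ l) • Tvec r P (ε l) := by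
      intro l; rw [← Finset.sum_smul, Matrix.mul_apply]
    simp_rw [this, hVU, Matrix.one_apply, ite_smul, one_smul, zero_smul, Finset.sum_ite_eq, Finset.mem_univ,
      if_true]
    rw [show ε l₀ = (galoisClosure E).val by simp [l₀], Tvec_val]
  rw [← hcomb]
  exact Submodule.sum_mem _ fun j _ => Submodule.smul_mem _ _ (Submodule.subset_span ⟨uB j, rfl⟩)

/-- `[P] ∈ B^p(A) ⊗ ℂ` for `P` satisfying (3.2). -/
theorem wedge_mem_span_Bp (hE : IsCMAlgebra E) (Φ : CMTypeOn E) (p : ℕ) (P : Set.powersetCard (Emb E) (2 * p))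
    (h32 : SatisfiesEq32 Φ (P : Finset (Emb E))) :
    wedge E (2 * p) P ∈ Submodule.span ℂ (Bp Φ p : Set (Hr E (2 * p))) := by
  refine Submodule.span_mono ?_ (wedge_mem_span_fvec (2 * p) P)
  rintro _ ⟨u, rfl⟩
  exact fvec_mem_Bp hE Φ p P h32 u

/-- **The second half of Theorem 3.1 holds** (kernel-proved). -/
theorem Theorem31_ge_holds : Theorem31_ge := by
  intro E _ _ _ _ hE Φ _ p
  rw [Submodule.span_le]
  rintro _ ⟨P, h32, rfl⟩
  exact wedge_mem_span_Bp hE Φ p P h32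

/-- **Gao–Ullmo Theorem 3.1 (Pohlmann's theorem) holds** — KERNEL-PROVED over the typed model. -/
theorem Theorem31_holds : Theorem31 := Theorem31_iff_ge.mpr Theorem31_ge_holds

end Final

/-! ### Theorem 3.1, "In particular" clause: `dim_ℚ B^p(A) = #{P : |P| = 2p, (3.2)}` — KERNEL-PROVED -/

section Finrank

/-- Rational vectors that are `ℚ`-linearly independent are `ℂ`-linearly independent (via a Hamel basis of `ℂ/ℚ`). -/
theorem linearIndependent_cast_of_rat {ι N : Type} {y : ι → N → ℚ} (hy : LinearIndependent ℚ y) :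
    LinearIndependent ℂ (fun i k => algebraMap ℚ ℂ (y i k)) := by
  rw [linearIndependent_iff'] at hy ⊢
  intro s c hc i hi
  let γ := Basis.ofVectorSpace ℚ ℂ
  suffices h : ∀ l, γ.repr (c i) l = 0 by
    have : γ.repr (c i) = 0 := Finsupp.ext h
    simpa using this
  intro l
  have key : ∀ k, ∑ j ∈ s, γ.repr (c j) l * y j k = 0 := by
    intro k
    have hk := congr_fun hc k
    simp only [Finset.sum_apply, Pi.smul_apply, smul_eq_mul, Pi.zero_apply] at hk
    have hk' : γ.repr (∑ j ∈ s, c j * algebraMap ℚ ℂ (y j k)) l = 0 := by rw [hk]; simp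
    rw [map_sum, Finsupp.coe_finsetSum, Finset.sum_apply] at hk'
    rw [← hk']
    refine Finset.sum_congr rfl fun j _ => ?_
    have : c j * algebraMap ℚ ℂ (y j k) = (y j k) • c j := by
      rw [mul_comm, Algebra.smul_def]
    rw [this, map_smul, Finsupp.smul_apply, smul_eq_mul, mul_comm]
  have := hy s (fun j => γ.repr (c j) l) (by
    funext k
    simp only [Finset.sum_apply, Pi.smul_apply, smul_eq_mul, Pi.zero_apply]
    exact key k) i hi
  exact this

variable {E : Type} [CommRing E] [Algebra ℚ E] [Module.Finite ℚ E]

/-- The rational vectors `b_m ∈ ℂ^S` are `ℂ`-linearly independent (columns of the invertible matrix `A`). -/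
theorem linearIndependent_ratVec_bE (hE : IsCMAlgebra E) : LinearIndependent ℂ (fun m => ratVec E (bE E m)) := by
  have h1 : LinearIndependent ℂ (AC hE).col := Matrix.linearIndependent_cols_iff_isUnit.mpr (isUnit_AC hE)
  let Φ : (Fin (finrank ℚ E) → ℂ) ≃ₗ[ℂ] (Emb E → ℂ) := LinearEquiv.funCongrLeft ℂ ℂ (embEquivFin hE)
  have h2 := h1.map' Φ.toLinearMap Φ.ker
  have h3 : (⇑Φ.toLinearMap ∘ (AC hE).col) = fun m => ratVec E (bE E m) := by
    funext m
    funext φ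
    simp [Φ, LinearEquiv.funCongrLeft_apply, LinearMap.funLeft_apply, AC, Matrix.col_apply]
  rw [h3] at h2
  exact h2

/-- The `ℂ`-basis `(b_m)_m` of `ℂ^S` consisting of RATIONAL vectors. -/
def ratBasis (hE : IsCMAlgebra E) : Basis (Fin (finrank ℚ E)) ℂ (VC E) :=
  basisOfLinearIndependentOfCardEqFinrank' _ (linearIndependent_ratVec_bE hE)
    (by rw [Fintype.card_fin, Module.finrank_pi, card_emb_eq_finrank hE])

/-- (Ported verbatim from the HodgeCMPerL package; no docstring in the source.) -/
@[simp] theorem ratBasis_apply (hE : IsCMAlgebra E) (m : Fin (finrank ℚ E)) : ratBasis hE m = ratVec E (bE E m) := by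
  simp [ratBasis]

/-- (Ported verbatim from the HodgeCMPerL package; no docstring in the source.) -/
theorem repr_ratBasis_ratVec (hE : IsCMAlgebra E) (a : E) (m : Fin (finrank ℚ E)) :
    (ratBasis hE).repr (ratVec E a) m = algebraMap ℚ ℂ ((bE E).repr a m) := by
  have : ratVec E a = ∑ m, (algebraMap ℚ ℂ ((bE E).repr a m)) • ratBasis hE m := by
    conv_lhs => rw [← (bE E).sum_repr a]
    rw [map_sum]
    refine Finset.sum_congr rfl fun m _ => ?_
    rw [map_smul, ratBasis_apply, algebraMap_smul]
  rw [this, (ratBasis hE).repr_sum_self]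

/-- The basis `W = (b_{g₁} ∧ ⋯ ∧ b_{g_r})_g` of `⋀^r ℂ^S` made of rational wedges. -/
abbrev ratWedgeBasis (hE : IsCMAlgebra E) (r : ℕ) :
    Basis (Set.powersetCard (Fin (finrank ℚ E)) r) ℂ (Hr E r) :=
  (ratBasis hE).exteriorPower r

/-- Rational classes have RATIONAL coordinates in the basis `W`. -/
theorem exists_rat_repr_of_mem_ratStr (hE : IsCMAlgebra E) (r : ℕ) {x : Hr E r} (hx : x ∈ ratStr E r)
    (g : Set.powersetCard (Fin (finrank ℚ E)) r) : ∃ q : ℚ, (ratWedgeBasis hE r).repr x g = algebraMap ℚ ℂ q := by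
  induction hx using Submodule.span_induction generalizing g with
  | mem x hx =>
    obtain ⟨a, rfl⟩ := hx
    refine ⟨(Matrix.of fun i j => (bE E).repr (a i) (Set.powersetCard.ofFinEmbEquiv.symm g j)).det, ?_⟩
    rw [← Basis.coord_apply, exteriorPower.basis_coord, exteriorPower.ιMultiDual_apply_ιMulti, RingHom.map_det]
    congr 1
    ext i j
    simp only [Matrix.of_apply, RingHom.mapMatrix_apply, Matrix.map_apply, Basis.coord_apply, repr_ratBasis_ratVec]
  | zero => exact ⟨0, by simp⟩
  | add x y _ _ hx hy =>
    obtain ⟨q₁, h₁⟩ := hx g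
    obtain ⟨q₂, h₂⟩ := hy g
    exact ⟨q₁ + q₂, by simp [h₁, h₂]⟩
  | smul q x _ hx =>
    obtain ⟨q₁, h₁⟩ := hx g
    refine ⟨q * q₁, ?_⟩
    have : (q • x : Hr E r) = (algebraMap ℚ ℂ q) • x := (algebraMap_smul ℂ q x).symm
    rw [this, map_smul, Finsupp.smul_apply, h₁, smul_eq_mul, map_mul]

/-- `H^r(A, ℚ)` is contained in the `ℚ`-span of `W`; in particular `B^p(A)` is finite-dimensional over `ℚ`. -/
theorem ratStr_le_span_ratWedge (hE : IsCMAlgebra E) (r : ℕ) :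
    ratStr E r ≤ Submodule.span ℚ (Set.range (ratWedgeBasis hE r)) := by
  intro x hx
  rw [← (ratWedgeBasis hE r).sum_repr x]
  refine Submodule.sum_mem _ fun g _ => ?_
  obtain ⟨q, hq⟩ := exists_rat_repr_of_mem_ratStr hE r hx g
  rw [hq, algebraMap_smul]
  exact Submodule.smul_mem _ q (Submodule.subset_span ⟨g, rfl⟩)

/-- The `W`-coordinate map `H^r → (𝒫_r → ℂ)` (a `ℂ`-linear injection). -/
def coordMap (hE : IsCMAlgebra E) (r : ℕ) : Hr E r →ₗ[ℂ] (Set.powersetCard (Fin (finrank ℚ E)) r → ℂ) :=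
  Finsupp.lcoeFun ∘ₗ (ratWedgeBasis hE r).repr.toLinearMap

/-- (Ported verbatim from the HodgeCMPerL package; no docstring in the source.) -/
@[simp] theorem coordMap_apply (hE : IsCMAlgebra E) (r : ℕ) (x : Hr E r) (g : Set.powersetCard (Fin (finrank ℚ E)) r) :
    coordMap hE r x g = (ratWedgeBasis hE r).repr x g := rfl

/-- (Ported verbatim from the HodgeCMPerL package; no docstring in the source.) -/
theorem coordMap_injective (hE : IsCMAlgebra E) (r : ℕ) : Function.Injective (coordMap hE r) := by
  intro x y h
  apply (ratWedgeBasis hE r).repr.injective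
  ext g
  exact congr_fun h g

/-- A `ℚ`-linearly independent family of RATIONAL classes is `ℂ`-linearly independent. -/
theorem linearIndependent_complex_of_rat_family (hE : IsCMAlgebra E) (r : ℕ) {ι : Type} (v : ι → Hr E r)
    (hv : ∀ i, v i ∈ ratStr E r) (hli : LinearIndependent ℚ v) : LinearIndependent ℂ v := by
  have hrat : ∀ i g, ∃ q : ℚ, (ratWedgeBasis hE r).repr (v i) g = algebraMap ℚ ℂ q :=
    fun i g => exists_rat_repr_of_mem_ratStr hE r (hv i) g
  choose y hy using hrat
  have hyQ : LinearIndependent ℚ y := by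
    rw [linearIndependent_iff'] at hli ⊢
    intro s d hd i hi
    refine hli s d ?_ i hi
    apply coordMap_injective hE r
    rw [map_sum, map_zero]
    funext g
    rw [Finset.sum_apply, Pi.zero_apply]
    have hdg := congr_fun hd g
    simp only [Finset.sum_apply, Pi.smul_apply, smul_eq_mul, Pi.zero_apply] at hdg
    calc ∑ j ∈ s, coordMap hE r (d j • v j) g
        = ∑ j ∈ s, algebraMap ℚ ℂ (d j * y j g) := by
          refine Finset.sum_congr rfl fun j _ => ?_
          rw [LinearMap.map_smul_of_tower, Pi.smul_apply, coordMap_apply, hy, Algebra.smul_def, map_mul]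
      _ = algebraMap ℚ ℂ (∑ j ∈ s, d j * y j g) := by rw [map_sum]
      _ = 0 := by rw [hdg, map_zero]
  have hcast := linearIndependent_cast_of_rat hyQ
  apply LinearIndependent.of_comp (coordMap hE r)
  have h3 : (⇑(coordMap hE r) ∘ v) = fun i g => algebraMap ℚ ℂ (y i g) := by
    funext i
    funext g
    exact hy i g
  rw [h3]
  exact hcast

variable [LinearOrder (Emb E)]

/-- `B^p(A)` is finite-dimensional over `ℚ`. -/
theorem finiteDimensional_Bp (hE : IsCMAlgebra E) (Φ : CMTypeOn E) (p : ℕ) : FiniteDimensional ℚ (Bp Φ p) := by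
  haveI : FiniteDimensional ℚ (Submodule.span ℚ (Set.range (ratWedgeBasis hE (2 * p)))) :=
    FiniteDimensional.span_of_finite ℚ (Set.finite_range _)
  exact Submodule.finiteDimensional_of_le ((inf_le_left).trans (ratStr_le_span_ratWedge hE (2 * p)))

/-- The `ℂ`-span of `B^p` is the `ℂ`-span of any `ℚ`-basis of `B^p`. -/
theorem span_Bp_eq_span_basis (Φ : CMTypeOn E) (p : ℕ) {ι : Type} [Fintype ι] (β : Module.Basis ι ℚ (Bp Φ p)) :
    Submodule.span ℂ (Bp Φ p : Set (Hr E (2 * p))) =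
      Submodule.span ℂ (Set.range fun i => ((β i : Bp Φ p) : Hr E (2 * p))) := by
  apply le_antisymm
  · rw [Submodule.span_le]
    intro x hx
    have h := congrArg (fun z : Bp Φ p => (z : Hr E (2 * p))) (β.sum_repr ⟨x, hx⟩)
    simp only [Submodule.coe_sum, Submodule.coe_smul_of_tower] at h
    have hmem : ∑ i, β.repr ⟨x, hx⟩ i • ((β i : Bp Φ p) : Hr E (2 * p)) ∈
        Submodule.span ℂ (Set.range fun i => ((β i : Bp Φ p) : Hr E (2 * p))) :=
      Submodule.sum_mem _ fun i _ => Submodule.smul_of_tower_mem _ _ (Submodule.subset_span ⟨i, rfl⟩)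
    rw [h] at hmem
    exact hmem
  · apply Submodule.span_mono
    rintro _ ⟨i, rfl⟩
    exact (β i).2

/-- A `ℚ`-basis of `B^p` is `ℂ`-linearly independent.  (Implementation note: only semiring-level
linear-independence lemmas are used on `↥(Bp Φ p)`, to keep instance unification cheap.) -/
theorem linearIndependent_complex_basis_Bp (hE : IsCMAlgebra E) (Φ : CMTypeOn E) (p : ℕ) {ι : Type}
    (β : Module.Basis ι ℚ (Bp Φ p)) : LinearIndependent ℂ (fun i => ((β i : Bp Φ p) : Hr E (2 * p))) := by
  have hli : LinearIndependent ℚ (fun i => ((β i : Bp Φ p) : Hr E (2 * p))) :=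
    β.linearIndependent.map_injOn (Bp Φ p).subtype (Bp Φ p).injective_subtype.injOn
  have hv : ∀ i, ((β i : Bp Φ p) : Hr E (2 * p)) ∈ ratStr E (2 * p) := fun i => (Submodule.mem_inf.mp (β i).2).1
  exact linearIndependent_complex_of_rat_family hE (2 * p) (fun i => ((β i : Bp Φ p) : Hr E (2 * p))) hv hli

/-- `dim_ℂ (B^p ⊗ ℂ) = dim_ℚ B^p` (inside `H^{2p}(A, ℂ)`). -/
theorem finrank_span_Bp (hE : IsCMAlgebra E) (Φ : CMTypeOn E) (p : ℕ) :
    finrank ℂ (Submodule.span ℂ (Bp Φ p : Set (Hr E (2 * p)))) = finrank ℚ (Bp Φ p) := by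
  haveI := finiteDimensional_Bp hE Φ p
  haveI : Module.Free ℚ (Bp Φ p) := Module.Free.of_divisionRing ℚ (Bp Φ p)
  rw [span_Bp_eq_span_basis Φ p (Module.finBasis ℚ (Bp Φ p)),
    finrank_span_eq_card (linearIndependent_complex_basis_Bp hE Φ p (Module.finBasis ℚ (Bp Φ p))),
    Fintype.card_fin]

/-- **Theorem 3.1 without the ordering convention** (a free strengthening of `Theorem31_holds`: neither half of the formal
proof uses `OrderConvention Φ`, the wedge basis being defined for ANY linear order on `S`): for a CM algebra `E`, a CM type `Φ`
and any `p`, `B^p(A) ⊗ ℂ = span_ℂ {[P] : |P| = 2p, (3.2)}` inside `H^{2p}(A, ℂ)`. -/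
theorem span_Bp_eq_span_wedge (hE : IsCMAlgebra E) (Φ : CMTypeOn E) (p : ℕ) :
    Submodule.span ℂ (Bp Φ p : Set (Hr E (2 * p))) =
      Submodule.span ℂ {x | ∃ P : Set.powersetCard (Emb E) (2 * p),
        SatisfiesEq32 Φ (P : Finset (Emb E)) ∧ x = wedge E (2 * p) P} := by
  refine le_antisymm (Theorem31_le Φ p) ?_
  rw [Submodule.span_le]
  rintro _ ⟨P, h32, rfl⟩
  exact wedge_mem_span_Bp hE Φ p P h32

/-- **`dim_ℚ B^p(A) = #{P ⊂ S : |P| = 2p, (3.2)}` without the ordering convention** (kernel-proved). -/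
theorem finrank_Bp_eq_card (hE : IsCMAlgebra E) (Φ : CMTypeOn E) (p : ℕ) :
    finrank ℚ (Bp Φ p) =
      Nat.card {P : Set.powersetCard (Emb E) (2 * p) // SatisfiesEq32 Φ (P : Finset (Emb E))} := by
  have hY : Submodule.span ℂ (Bp Φ p : Set (Hr E (2 * p))) =
      Submodule.span ℂ (Set.range fun P : {P : Set.powersetCard (Emb E) (2 * p) //
        SatisfiesEq32 Φ (P : Finset (Emb E))} => wedge E (2 * p) P.1) := by
    rw [span_Bp_eq_span_wedge hE Φ p]
    congr 1
    ext x
    constructor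
    · rintro ⟨P, hP, rfl⟩; exact ⟨⟨P, hP⟩, rfl⟩
    · rintro ⟨⟨P, hP⟩, rfl⟩; exact ⟨P, hP, rfl⟩
  have hliA : LinearIndependent ℂ (fun P : {P : Set.powersetCard (Emb E) (2 * p) //
      SatisfiesEq32 Φ (P : Finset (Emb E))} => wedge E (2 * p) P.1) :=
    (linearIndependent_wedge (2 * p)).comp _ Subtype.val_injective
  rw [← finrank_span_Bp hE Φ p, hY, finrank_span_eq_card hliA, Nat.card_eq_fintype_card]

/-- **Theorem 3.1, "In particular" clause, holds** (kernel-proved): `dim_ℚ B^p(A) = #{P ∈ 𝒫(S) : |P| = 2p, (3.2)}`. -/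
theorem Theorem31_finrank_holds : Theorem31_finrank :=
  fun _E _ _ _ _ hE Φ _ p => finrank_Bp_eq_card hE Φ p

end Finrank

end GaoUllmo
end HodgeCM

end

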